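import Summits.BirchSwinnertonDyer.BirchSwinnertonDyer.Theorems.ManinLocalTwoThreeBlindNoDoubling
import HarnessLib

/-!
# E-an-66 AT THE TAME BLIND FAMILY'S LEVELS `N = 4p`: a totally blind optimal curve has `|c₀| = |c₁|`, so there
# C2 (`2 ∤ c₀`) ⟺ Stevens' parity (`2 ∤ c₁`) — unconditionally

Summit `BirchSwinnertonDyer`, route `ManinLocalTwoThree` (cell bsd-f2-manin), deciding crux C2 `ManinOddAtFour`
(stmt-BirchSwinnertonDyer-22967), blind tame residual (`stub_blindTameOptimalOddDegree`, levels `N = 4(m² + 4) = 4p`; an rows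
E-an-66 `TotallyBlindGammaOneTransfer`, E-an-69/70).  Assembly of tree theorems: the ledger `|c₀| ∈ {|c₁|, 2|c₁|}` (p629489),
«blind ∧ doubled ⟹ index `4`» (`index_four_of_allBlind_of_natAbs_eq_two_mul`, p634444) and «no index `4` at `N = 4q`»
(`not_periodLatticeGamma1_eq_two_mul_of_four_mul`, p632017):

* `natAbs_maninConstant₀_eq_of_allBlind_of_four_mul[_prime]` — for the optimal `X₁`/`X₀` pair of a class at `N = 4q`
  (`q` odd, `(ℤ/q)ˣ` cyclic; in particular `N = 4p`), `W₀ = [0, a₂, 0, a₄, a₆]` with all rational `2`-torsion blind: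
  `|c₀| = |c₁|` — the an planner's E-an-66 restricted to these levels, with NO printed-fact hypothesis;
* `not_two_dvd_maninConstant₀_iff_of_allBlind_of_four_mul_prime` — there, `2 ∤ c₀ ⟺ 2 ∤ c₁`: Manin's conjecture at `2`
  for the totally blind optimal curve IS Stevens' parity for its `X₁(N)`-optimal isogenous curve;
* `totallyBlindGammaOneTransfer_of_noIndexFour` — at general `4 ∣ N`, E-an-66 follows from the single statement «no blind
  optimal pair has `Λ₁(f) = 2Λ₀(f)`» (E-an-68's configuration; on paper excluded by the `μ`-type structure of `Σ(N)`,
  Ling–Oesterlé Thm. 1, not in the tree).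

HONEST FRAMING: the parity of `c₁` (Stevens / CES Conj. 6.1.7) stays open; C2, Manin's conjecture and BSD are not proved.
No definitions.
-/

set_option autoImplicit false
-- the summit-side namespace `Summit.BirchSwinnertonDyer.BirchSwinnertonDyer.…` is the tree's (summit = sub-problem)
set_option linter.dupNamespace false

noncomputable section

open WeierstrassCurve Literature.NumberTheory.EllipticCurves Literature.NumberTheory.EllipticCurves.ModularForms
open CongruenceSubgroup
open Summit.BirchSwinnertonDyer.Rank1Residual.ManinAdditive.ShimuraLedger

namespace Summit.BirchSwinnertonDyer.BirchSwinnertonDyer.Theorems.ManinLocalTwoThree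

variable {W₁ W₀ : WeierstrassCurve ℚ} [W₁.IsElliptic] [W₁.IsGloballyMinimal] [W₀.IsElliptic]
  [W₀.IsGloballyMinimal]

/-- **E-an-66 at `N = 4q`** (`q` odd, `(ℤ/q)ˣ` cyclic): for the optimal `X₁(N)`-datum `D₁` and the optimal `X₀(N)`-datum
`D₀` of a class, `W₀ = [0, a₂, 0, a₄, a₆]` with every rational `2`-torsion point Kummer-blind, `|c₀| = |c₁|`.
(Doubling would force `Λ₁(f) = 2Λ₀(f)`, impossible at these levels.) -/
theorem natAbs_maninConstant₀_eq_of_allBlind_of_four_mul {q : ℕ} (hq : Odd q) [IsCyclic (ZMod q)ˣ] [NeZero (4 * q)]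
    (D₁ : Gamma1ParametrizationData W₁ (4 * q)) (D₀ : ModularParametrizationData W₀ (4 * q))
    (hiso : IsIsogenous W₁ W₀) (h₁ : D₁.IsOptimal)
    (h₀ : ∀ z ∈ D₀.L.lattice, ∃ w ∈ periodLattice D₀.f, z = D₀.c * w)
    (ha₁ : W₀.a₁ = 0) (ha₃ : W₀.a₃ = 0) (hblind : AllRationalTwoTorsionBlind W₀) :
    D₀.maninConstant.natAbs = D₁.maninConstant.natAbs := by
  have h4 : 2 ^ 2 ∣ 4 * q := ⟨q, by ring⟩
  rcases natAbs_maninConstant₀_eq_or_eq_two_mul_of_four_dvd_level D₁ D₀ hiso h₁ h₀ h4 with h | h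
  · exact h
  · exfalso
    have hf : D₁.f = D₀.f := D₁.f_eq_of_isIsogenous D₀ hiso
    have hidx := index_four_of_allBlind_of_natAbs_eq_two_mul D₁ D₀ hiso h₁ h₀ h4 ha₁ ha₃ hblind h
    rw [hf] at hidx
    exact not_periodLatticeGamma1_eq_two_mul_of_four_mul hq D₀ h₀ hidx

/-- **E-an-66 at `N = 4p`, `p` an odd prime** (the levels of the tame blind family `p = m² + 4`): totally blind optimal
`W₀` ⟹ `|c₀| = |c₁|`. -/
theorem natAbs_maninConstant₀_eq_of_allBlind_of_four_mul_prime {p : ℕ} (hp : p.Prime) (hp2 : p ≠ 2) [NeZero (4 * p)]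
    (D₁ : Gamma1ParametrizationData W₁ (4 * p)) (D₀ : ModularParametrizationData W₀ (4 * p))
    (hiso : IsIsogenous W₁ W₀) (h₁ : D₁.IsOptimal)
    (h₀ : ∀ z ∈ D₀.L.lattice, ∃ w ∈ periodLattice D₀.f, z = D₀.c * w)
    (ha₁ : W₀.a₁ = 0) (ha₃ : W₀.a₃ = 0) (hblind : AllRationalTwoTorsionBlind W₀) :
    D₀.maninConstant.natAbs = D₁.maninConstant.natAbs := by
  haveI : IsCyclic (ZMod p)ˣ := ZMod.isCyclic_units_prime hp
  exact natAbs_maninConstant₀_eq_of_allBlind_of_four_mul (hp.odd_of_ne_two hp2) D₁ D₀ hiso h₁ h₀ ha₁ ha₃ hblind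

/-- **At `N = 4p`, on a totally blind optimal curve: `2 ∤ c₀ ⟺ 2 ∤ c₁`** — Manin's conjecture at `2` for `D₀` is exactly
Stevens' parity for the `X₁(N)`-optimal datum `D₁` of the class (and more: `ℓ ∣ c₀ ⟺ ℓ ∣ c₁` for every `ℓ`). -/
theorem not_two_dvd_maninConstant₀_iff_of_allBlind_of_four_mul_prime {p : ℕ} (hp : p.Prime) (hp2 : p ≠ 2)
    [NeZero (4 * p)] (D₁ : Gamma1ParametrizationData W₁ (4 * p)) (D₀ : ModularParametrizationData W₀ (4 * p))
    (hiso : IsIsogenous W₁ W₀) (h₁ : D₁.IsOptimal)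
    (h₀ : ∀ z ∈ D₀.L.lattice, ∃ w ∈ periodLattice D₀.f, z = D₀.c * w)
    (ha₁ : W₀.a₁ = 0) (ha₃ : W₀.a₃ = 0) (hblind : AllRationalTwoTorsionBlind W₀) :
    ¬ (2 : ℤ) ∣ D₀.maninConstant ↔ ¬ (2 : ℤ) ∣ D₁.maninConstant := by
  have heq := natAbs_maninConstant₀_eq_of_allBlind_of_four_mul_prime hp hp2 D₁ D₀ hiso h₁ h₀ ha₁ ha₃ hblind
  rw [← Int.natAbs_dvd_natAbs, ← Int.natAbs_dvd_natAbs (b := D₁.maninConstant), heq]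

/-- Divisor form: at `N = 4p`, on a totally blind optimal curve, `ℓ ∣ c₀ ⟺ ℓ ∣ c₁` for every integer `ℓ`. -/
theorem dvd_maninConstant₀_iff_of_allBlind_of_four_mul_prime {p : ℕ} (hp : p.Prime) (hp2 : p ≠ 2)
    [NeZero (4 * p)] (D₁ : Gamma1ParametrizationData W₁ (4 * p)) (D₀ : ModularParametrizationData W₀ (4 * p))
    (hiso : IsIsogenous W₁ W₀) (h₁ : D₁.IsOptimal)
    (h₀ : ∀ z ∈ D₀.L.lattice, ∃ w ∈ periodLattice D₀.f, z = D₀.c * w)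
    (ha₁ : W₀.a₁ = 0) (ha₃ : W₀.a₃ = 0) (hblind : AllRationalTwoTorsionBlind W₀) (ℓ : ℤ) :
    ℓ ∣ D₀.maninConstant ↔ ℓ ∣ D₁.maninConstant := by
  have heq := natAbs_maninConstant₀_eq_of_allBlind_of_four_mul_prime hp hp2 D₁ D₀ hiso h₁ h₀ ha₁ ha₃ hblind
  rw [← Int.natAbs_dvd_natAbs, ← Int.natAbs_dvd_natAbs (b := D₁.maninConstant), heq]

/-- **E-an-66 `TotallyBlindGammaOneTransfer` at general `4 ∣ N` ⟸ «no index `4` on blind optimal pairs».**  The only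
configuration in which a totally blind optimal curve can have `|c₀| = 2|c₁|` is `Λ₁(f) = 2Λ₀(f)` (E-an-68's case); so if
that is excluded (`h`; true at `N = 4p` by `not_periodLatticeGamma1_eq_two_mul_of_four_mul`, and on paper in general by
the `μ`-type structure of the Shimura subgroup), the an planner's E-an-66 holds BY NAME. -/
theorem totallyBlindGammaOneTransfer_of_noIndexFour
    (h : ∀ (W₁ W₀ : WeierstrassCurve ℚ) [W₁.IsElliptic] [W₁.IsGloballyMinimal] [W₀.IsElliptic]
      [W₀.IsGloballyMinimal] {N : ℕ} [NeZero N] (D₁ : Gamma1ParametrizationData W₁ N)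
      (D₀ : ModularParametrizationData W₀ N), IsIsogenous W₁ W₀ → D₁.IsOptimal →
      (∀ z ∈ D₀.L.lattice, ∃ w ∈ periodLattice D₀.f, z = D₀.c * w) → 2 ^ 2 ∣ N → W₀.a₁ = 0 → W₀.a₃ = 0 →
      AllRationalTwoTorsionBlind W₀ →
      ¬ (∀ z : ℂ, z ∈ periodLatticeGamma1 D₁.f ↔ ∃ w ∈ periodLattice D₀.f, z = 2 * w)) :
    TotallyBlindGammaOneTransfer := by
  intro W₁ W₀ _ _ _ _ N _ D₁ D₀ hiso h₁ h₀ h4 ha₁ ha₃ hblind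
  rcases natAbs_maninConstant₀_eq_or_eq_two_mul_of_four_dvd_level D₁ D₀ hiso h₁ h₀ h4 with h' | h'
  · exact h'
  · exact absurd (index_four_of_allBlind_of_natAbs_eq_two_mul D₁ D₀ hiso h₁ h₀ h4 ha₁ ha₃ hblind h')
      (h W₁ W₀ D₁ D₀ hiso h₁ h₀ h4 ha₁ ha₃ hblind)

/-- **C2 on the totally blind optimal curves at `N = 4p` ⟸ (existence of Stevens' datum) ∧ (Stevens' parity there).**
With the printed F-need `exists_optimal_gamma1ParametrizationData` (Conrad–Edixhoven–Stein §6.1, statement-only) and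
`2 ∤ c₁` for the `X₁(4p)`-optimal data of the classes of totally blind `X₀(4p)`-optimal curves (`hS`, inline; CES
Conj. 6.1.7 predicts `c₁ = 1`), every such curve has odd Manin constant. -/
theorem not_two_dvd_maninConstant_of_allBlind_four_mul_prime (hex : exists_optimal_gamma1ParametrizationData)
    {p : ℕ} (hp : p.Prime) (hp2 : p ≠ 2) [NeZero (4 * p)]
    (hS : ∀ (W₁ W₀ : WeierstrassCurve ℚ) [W₁.IsElliptic] [W₁.IsGloballyMinimal] [W₀.IsElliptic]
      [W₀.IsGloballyMinimal] (D₁ : Gamma1ParametrizationData W₁ (4 * p)) (D₀ : ModularParametrizationData W₀ (4 * p)),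
      IsIsogenous W₁ W₀ → D₁.IsOptimal → (∀ z ∈ D₀.L.lattice, ∃ w ∈ periodLattice D₀.f, z = D₀.c * w) →
      W₀.a₁ = 0 → W₀.a₃ = 0 → AllRationalTwoTorsionBlind W₀ → ¬ (2 : ℤ) ∣ D₁.maninConstant)
    (D₀ : ModularParametrizationData W₀ (4 * p)) (h₀ : ∀ z ∈ D₀.L.lattice, ∃ w ∈ periodLattice D₀.f, z = D₀.c * w)
    (ha₁ : W₀.a₁ = 0) (ha₃ : W₀.a₃ = 0) (hblind : AllRationalTwoTorsionBlind W₀) :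
    ¬ (2 : ℤ) ∣ D₀.maninConstant := by
  obtain ⟨W₁, i₁, i₂, D₁, hiso, h₁⟩ := hex W₀ D₀ h₀
  exact (not_two_dvd_maninConstant₀_iff_of_allBlind_of_four_mul_prime hp hp2 D₁ D₀ hiso h₁ h₀ ha₁ ha₃ hblind).mpr
    (hS W₁ W₀ D₁ D₀ hiso h₁ h₀ ha₁ ha₃ hblind)

end Summit.BirchSwinnertonDyer.BirchSwinnertonDyer.Theorems.ManinLocalTwoThree

end
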